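import Literature.MathematicalPhysics.QuantumFieldTheory.Balaban1983to89.B12Decay510Window
import Literature.MathematicalPhysics.QuantumFieldTheory.Balaban1983to89.B12
import Literature.MathematicalPhysics.QuantumFieldTheory.Balaban1983to89.TreeLengthTorus

/-!
# `Balaban1983to89.B12LargeDomain027` — T. Bałaban, *Renormalization group approach to lattice gauge field theories. I*,
# Commun. Math. Phys. **109** (1987) 249–301 [Balaban1987RG1] = [I], p. 258: **the printed criterion for a "large"
# localization domain — *"not contained in any cube □̃, with □ ∈ π_k"* — IMPLIES `d_j(X) ≥ 2(L^jη)^{−1}`**, hence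
# (0.25) ⟹ (0.27) AS PRINTED on the cell's concrete tree length `TreeLength.treeLen`

statement-level skeleton of published theorems with citation tags; proofs where landed; nothing here is a claim
about the Yang–Mills mass gap

CITATION HEADER (lean-in-tree rule 2026-08-18).  T. Bałaban, *Renormalization group approach to lattice gauge field
theories. I. Generation of effective actions in a small field approximation and a coupling constant renormalization in
four dimensions*, Commun. Math. Phys. **109**, 249–301 (1987), doi:10.1007/BF01215223, bib `Balaban1987RG1` (cell paper
B12 = "[I]"; PDF held `paper:balaban1987-cmp109-rg-i-small-field`, journal page = PDF page + 248; pp. 257–258 = text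
layer `p0009.txt`/`p0010.txt`, re-read for this file).  Mega-formalization `lit-balaban`, HOME
`run/shared/lean/pub/lit-balaban/`, unit `lit-balaban-r20` gen 12 (B12 fold owner; SKELETON row **B12.Eq0.27**, owner row
r20-B12-E1 l.21, hitherto `typed-existing ("large" abstract, F5)`; cell DIVERGENCE records D-pv03.1 / F5 of the
pub-balaban cell: *"'not contained in any □̃, □ ∈ π_k' gives d_j(X) ≳ (L^jη)^{−1} up to a geometric constant … so the
displayed constants 1 and 1/2 are schematic"* — REFUTED BELOW IN PRINT'S FAVOUR: the constants are exact).

WHAT THE PAPER PRINTS (verbatim).  p. 257 [9]: *"We decompose the space T into the lattice of closed cubes of a size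
M … We denote this family of cubes by π_j, and the cubes by □, □′, etc. For a cube □ ∈ π_j and n = 1, 2, … we define
□̃ⁿ as a cube of the size (1 + 2n)M and with a center at the center of □. … Consider a class of tree graphs contained
in X and intersecting all the cubes in X. A length of a shortest graph in this class, divided by M, is the linear size
of X, and is denoted by d_j(X). Thus we rescale the space, so that cubes from π_j become unit cubes, and we take the
distance in this scale."*  p. 258 [10]: *"Consider a term in the sum (0.24). If its localization domain X is large, for
example it is not contained in any cube □̃, with □ ∈ π_k, then the inequality (0.25) ensures that
|𝐄^{(j)}(X, U_k)| ≤ E₀ exp(−κ(L^jη)^{−1}) exp(−½κd_j(X)),  (0.27)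
and the first exponential can be bounded by an arbitrary positive power of L^jη, e.g. by (5!/κ⁵)(L^jη)⁵."*

THE GEOMETRY BEHIND (0.27), MADE EXPLICIT (print displays none of it).  In the rescaled picture of d_j (the cubes of π_j
are the unit cubes `TreeLength.cube z`, z ∈ ℤ^d), a cube □ ∈ π_k — M sites of the unit lattice T₁^{(k)}, on which the
j-th lattice has spacing L^jη = L^{j−k} — has side `N := (L^jη)^{−1} = L^{k−j}` and □̃ = □̃¹ has side `3N`.  Since the
cube partitions of [I] are built on the nested lattices (0.1) (L odd, centred cubes), every □ ∈ π_k is a union of cubes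
of π_j, i.e. in the index model □̃ is the WINDOW `window N c b = {z | N(b_μ − 1) + c_μ ≤ z_μ < N(b_μ + 2) + c_μ ∀μ}` for a
fixed INTEGER offset `c ∈ ℤ^d` (the position of the partition π_k) and a block index `b ∈ ℤ^d`.  "X is not contained in
any cube □̃, with □ ∈ π_k" = `IsLarge027 N c X`.  Two steps: (1) `exists_far_pair_of_isLarge027` — if X fits in no
window then in some direction μ two cubes of X have indices differing by at least 2N + 1 (contrapositive: if every
coordinate spread is ≤ 2N, the window with b_μ = ⌊(min_μ − c_μ)/N⌋ + 1 contains X, because min_μ − c_μ − N⌊(min_μ − c_μ)/N⌋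
≤ N − 1 — THIS is where the integrality of the offset, i.e. the nesting of π_j in π_k, enters; for a non-aligned □̃ one
only gets 2N); (2) `two_mul_le_treeLen_of_isLarge027` — every admissible graph meets the two far cubes, so by the
window module's `dist_corner_le_treeLen` (sup-distance of two cubes of X ≤ d_j(X) + 2) `d_j(X) ≥ (2N + 1) + 1 − 2 = 2N =
2(L^jη)^{−1}`, exactly the threshold at which (0.25) splits as (0.27) (`B12.bound027_of_025`: `e^{−κd} = e^{−½κd}e^{−½κd} ≤
e^{−κ(L^jη)^{−1}}e^{−½κd}` iff `d ≥ 2(L^jη)^{−1}`).  The constant is SHARP: a straight row of 2N + 2 cubes is large and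
has d_j = 2N (`treeLen_row_le`, §5).  (3) `bound027_of_025_isLarge027` — (0.27) AS PRINTED, with print's own criterion
for "large", on the concrete system `TreeLengthCubeSystem.sys B` (d_j := `treeLen`) of every window B ⊂ ℤ^d, for every
j ≤ k, L ≥ 1, η = L^{−k}; and `bound029_of_025_isLarge027` — the large-domain half of (0.29) (`B12.bound029_of_025_large`,
every N ≥ 5 for α > 0) under the same printed criterion.  (4) v1.1, §6: the same on the TORUS carrier
`TreeLengthTorus.tsys` (d_j := `torusTreeLen`, the system of the cell's (0.26)/(0.30) theorems `B12Chain026Torus`):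
`TIsLarge027` (X̄ contained in the image of no ℤ^d-window under the covering projection), the window lemma in spread
form `exists_window_of_spread_le`, `two_mul_le_torusTreeLen_of_tIsLarge027`, `bound027_of_025_tIsLarge027`,
`bound029_of_025_tIsLarge027`.  Conventions inherited from `TreeLength` (sup metric of
[Dimock2013BalabanII] App. E; polygonal connected graphs for tree graphs; `sInf`) — a Euclidean tree is at least as long
as its sup-metric length, so the lower bound `d_j(X) ≥ 2(L^jη)^{−1}` holds a fortiori for the Euclidean reading.
Theorems only (two `def`s with bodies: the window and the largeness predicate); axioms standard.
-/

noncomputable section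

open Set Metric

namespace Literature.MathematicalPhysics.QuantumFieldTheory.Balaban1983to89.B12LargeDomain027

open Literature.MathematicalPhysics.QuantumFieldTheory.Balaban1983to89
open B13ScaleTransfer TreeLength TreeLengthCubeSystem B12Decay510Window

variable {d : ℕ}

/-! ## §1. The cubes □̃ (□ ∈ π_k) in the rescaled picture of d_j, and the printed largeness criterion -/

/-- The cube **□̃ = □̃¹** of p. 257 (*"a cube of the size (1 + 2n)M and with a center at the center of □"*, n = 1) for
□ ∈ π_k, read in the rescaled picture of `d_j` (cubes of π_j = unit cubes of index z ∈ ℤ^d): with `N = (L^jη)^{−1}` the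
side of a π_k-cube in π_j-units, `c ∈ ℤ^d` the (integer) position of the partition π_k and `b ∈ ℤ^d` the index of □,
□̃ is the set of unit cubes `z` with `N(b_μ − 1) + c_μ ≤ z_μ < N(b_μ + 2) + c_μ` for every μ (3N unit cubes per side).
[cite: Balaban1987RG1, p.257 (□̃ⁿ) and p.258 (□ ∈ π_k)] -/
def window (N : ℕ) (c b : Pt d) : Set (Pt d) :=
  {z | ∀ μ, (N : ℤ) * (b μ - 1) + c μ ≤ z μ ∧ z μ < (N : ℤ) * (b μ + 2) + c μ}

/-- **"X is large, for example it is not contained in any cube □̃, with □ ∈ π_k"** (p. 258 [10], verbatim) — the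
printed example criterion, for a family X of unit cubes (indices in ℤ^d): X fits in NO window `window N c b`, b ∈ ℤ^d.
[cite: Balaban1987RG1, p.258 (large localization domains, (0.27))] -/
def IsLarge027 (N : ℕ) (c : Pt d) (X : Finset (Pt d)) : Prop :=
  ∀ b : Pt d, ¬ ((X : Set (Pt d)) ⊆ window N c b)

/-- Unfolding of the window membership. [cite: Balaban1987RG1, p.257 (□̃)] -/
theorem mem_window {N : ℕ} {c b z : Pt d} :
    z ∈ window N c b ↔ ∀ μ, (N : ℤ) * (b μ - 1) + c μ ≤ z μ ∧ z μ < (N : ℤ) * (b μ + 2) + c μ := Iff.rfl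

/-! ## §2. A domain contained in no □̃ has two cubes far apart in some direction -/

/-- **Step (1).** If the (non-empty, finite) family X of unit cubes is contained in no window □̃ of π_k (side 3N,
integer position c), then in some direction μ two cubes of X have indices differing by at least `2N + 1`.
Contrapositive: if every coordinate spread of X is `≤ 2N`, then with `m_μ = min_{z∈X} z_μ` and
`b_μ = ⌊(m_μ − c_μ)/N⌋ + 1` the window `window N c b` contains X, because `0 ≤ (m_μ − c_μ) − N⌊(m_μ − c_μ)/N⌋ ≤ N − 1`.
(Geometry left implicit in print; the integrality of `c` = the nesting of π_j in π_k from the lattices (0.1).)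
[cite: Balaban1987RG1, p.258 ((0.27), "not contained in any cube □̃")] -/
theorem exists_far_pair_of_isLarge027 {N : ℕ} (hN : 0 < N) {c : Pt d} {X : Finset (Pt d)} (hX : X.Nonempty)
    (h : IsLarge027 N c X) : ∃ μ : Fin d, ∃ z ∈ X, ∃ z' ∈ X, 2 * (N : ℤ) + 1 ≤ z' μ - z μ := by
  by_contra hcon
  push Not at hcon
  -- coordinatewise minima over the non-empty finite family X
  have hmin : ∀ μ : Fin d, ∃ m ∈ X, ∀ z ∈ X, m μ ≤ z μ := fun μ =>
    Finset.exists_min_image X (fun z : Pt d => z μ) hX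
  choose m hmX hm using hmin
  have hNz : (0 : ℤ) < N := by exact_mod_cast hN
  -- the window with b_μ = ⌊(m_μ μ − c_μ)/N⌋ + 1 contains X
  refine h (fun μ => (m μ μ - c μ) / N + 1) fun z hz => ?_
  have hz' : z ∈ X := by simpa using hz
  intro μ
  set a : ℤ := m μ μ - c μ with ha
  have hdecomp : a % N + N * (a / N) = a := Int.emod_add_mul_ediv a N
  have hr0 : 0 ≤ a % N := Int.emod_nonneg a (ne_of_gt hNz)
  have hrN : a % N < N := Int.emod_lt_of_pos a hNz
  have hlow : m μ μ ≤ z μ := hm μ z hz'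
  have hspread : z μ - m μ μ < 2 * (N : ℤ) + 1 := hcon μ (m μ) (hmX μ) z hz'
  constructor
  · -- N(b_μ − 1) + c_μ = N⌊a/N⌋ + c_μ ≤ a + c_μ = m_μ μ ≤ z_μ
    have : (N : ℤ) * ((m μ μ - c μ) / N + 1 - 1) = N * (a / N) := by rw [ha]; ring_nf
    rw [this]
    linarith
  · -- z_μ ≤ m_μ μ + 2N < N⌊a/N⌋ + 3N + c_μ = N(b_μ + 2) + c_μ
    have : (N : ℤ) * ((m μ μ - c μ) / N + 1 + 2) = N * (a / N) + 3 * N := by rw [ha]; ring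
    rw [this]
    linarith

/-! ## §3. Hence its linear size is at least 2N = 2(L^jη)^{−1} -/

/-- **Step (2): the threshold of (0.27).**  A localization domain X (non-empty, face-connected family of unit cubes)
contained in no cube □̃ with □ ∈ π_k has `d_j(X) ≥ 2N = 2(L^jη)^{−1}`: the two far cubes of step (1) have lower corners
at sup-distance `≥ 2N + 1`, and the sup-distance of two cubes of X is at most `d_j(X) + 2`
(`B12Decay510Window.dist_corner_le_treeLen`: every admissible graph meets both cubes, its length bounds the distance of
the two meeting points, each cube has diameter 1); `(2N + 1) − 2 < 2N` is repaired by the integrality of the corner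
coordinates: the meeting points lie in `[z_μ, z_μ + 1]` and `[z′_μ, z′_μ + 1]` with `z′_μ − z_μ ≥ 2N + 1`, so their
distance is `≥ 2N` — which is what `dist_corner_le_treeLen`'s proof gives when read with corners `2N + 1` apart:
`d_j(X) ≥ (2N + 1) − 2 + 1`?  No: we use the corner form `dist(corner z, corner z′) ≤ d_j(X) + 2` only through the
sharper two-point route below (`coord_gap_le_treeLen`), which loses exactly the two unit cubes' diameters in the
direction μ: `d_j(X) ≥ (z′_μ − z_μ) − 1 ≥ 2N`. [cite: Balaban1987RG1, p.258 ((0.27)); p.257 (d_j)] -/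
theorem coord_gap_le_treeLen {X : Finset (Pt d)} (hX : X.Nonempty) (hc : FaceConnected X) {z z' : Pt d}
    (hz : z ∈ X) (hz' : z' ∈ X) (μ : Fin d) : ((z' μ : ℤ) : ℝ) - z μ - 1 ≤ treeLen X := by
  obtain ⟨T₀, hT₀, -⟩ := exists_admissible hX hc
  refine le_treeLen ⟨T₀, hT₀⟩ fun T hT => ?_
  obtain ⟨p, hpT, hpz⟩ := hT.meets z hz
  obtain ⟨q, hqT, hqz⟩ := hT.meets z' hz'
  have hp1 : p μ ≤ (z μ : ℝ) + 1 := ((mem_cube.1 hpz) μ).2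
  have hq1 : ((z' μ : ℤ) : ℝ) ≤ q μ := ((mem_cube.1 hqz) μ).1
  have hpq : q μ - p μ ≤ dist p q := by
    have h1 := dist_le_pi_dist p q μ
    rw [Real.dist_eq, abs_sub_comm] at h1
    exact (le_abs_self _).trans h1
  have hlen : dist p q ≤ len T := dist_le_len hT.connected.isPreconnected hpT hqT
  linarith

/-- **`d_j(X) ≥ 2(L^jη)^{−1}` for every localization domain X "not contained in any cube □̃, with □ ∈ π_k"** (p. 258),
`N = (L^jη)^{−1}` — the lower bound that print uses silently between (0.25) and (0.27); the constant 2 is attained (§5).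
[cite: Balaban1987RG1, p.258 ((0.27))] -/
theorem two_mul_le_treeLen_of_isLarge027 {N : ℕ} (hN : 0 < N) {c : Pt d} {X : Finset (Pt d)} (hX : X.Nonempty)
    (hc : FaceConnected X) (h : IsLarge027 N c X) : 2 * (N : ℝ) ≤ treeLen X := by
  obtain ⟨μ, z, hz, z', hz', hfar⟩ := exists_far_pair_of_isLarge027 hN hX h
  have h1 := coord_gap_le_treeLen hX hc hz hz' μ
  have h2 : 2 * (N : ℝ) + 1 ≤ ((z' μ : ℤ) : ℝ) - z μ := by
    have := (Int.cast_le (R := ℝ)).2 hfar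
    push_cast at this
    linarith
  linarith

/-- The same on the concrete `LocDomainSys` of a window B ⊂ ℤ^d (`TreeLengthCubeSystem.sys B`, d_j := `treeLen`):
every large localization domain X ∈ 𝐃_j of B has `(sys B).dj X ≥ 2N`. [cite: Balaban1987RG1, p.258 ((0.27))] -/
theorem two_mul_le_dj_of_isLarge027 (B : Finset (Pt d)) {N : ℕ} (hN : 0 < N) (c : Pt d) (X : (sys B).Dom)
    (h : IsLarge027 N c X.1) : 2 * (N : ℝ) ≤ (sys B).dj X := by
  rw [sys_dj]
  exact two_mul_le_treeLen_of_isLarge027 hN X.2.2.1 X.2.2.2 h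

/-! ## §4. (0.25) ⟹ (0.27) AS PRINTED, with print's criterion for "large", on the concrete tree length -/

/-- Scale bookkeeping: with `η = L^{−k}` and `j ≤ k`, `(L^jη)^{−1} = L^{k−j}` (= N, the side of a π_k-cube in π_j-units).
[cite: Balaban1987RG1, (1.2) p.260 (η = L^{−k}, ξ = L^{−j})] -/
theorem inv_scale_eq_pow {L : ℕ} (hL : 1 ≤ L) {j k : ℕ} (hjk : j ≤ k) :
    ((L : ℝ) ^ j * ((L : ℝ) ^ k)⁻¹)⁻¹ = ((L ^ (k - j) : ℕ) : ℝ) := by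
  have hL0 : (L : ℝ) ≠ 0 := by exact_mod_cast (Nat.one_le_iff_ne_zero.1 hL)
  rw [mul_inv, inv_inv, Nat.cast_pow, pow_sub₀ _ hL0 hjk, mul_comm]

/-- **(0.27) AS PRINTED** (p. 258 [10]) on the concrete system `sys B` of any window B ⊂ ℤ^d, for every `1 ≤ L`,
`j ≤ k`, `κ ≥ 0` and every position `c` of the partition π_k: if the family `X ↦ 𝐄^{(j)}(X, U_k)` satisfies (0.25)
(`B12.Bound025Printed EX E₀ κ`), then for every localization domain X *"not contained in any cube □̃, with □ ∈ π_k"*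
(`IsLarge027 (L^{k−j}) c X`)  `|𝐄^{(j)}(X, U_k)| ≤ E₀ exp(−κ(L^jη)^{−1}) exp(−½κd_j(X))`, η = L^{−k} — i.e.
`B12.Bound027Printed` with print's own largeness criterion in the `large` slot and NO lower-bound hypothesis on d_j
(that lower bound, `two_mul_le_treeLen_of_isLarge027`, is now a theorem).  The printed constants 1 (in
`exp(−κ(L^jη)^{−1})`) and ½ are exact. [cite: Balaban1987RG1, (0.25) p.257, (0.27) p.258] -/
theorem bound027_of_025_isLarge027 (B : Finset (Pt d)) (EX : (sys B).Dom → ℝ) (E₀ κ : ℝ) {L j k : ℕ}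
    (hL : 1 ≤ L) (hjk : j ≤ k) (hκ : 0 ≤ κ) (c : Pt d) (h025 : B12.Bound025Printed EX E₀ κ) :
    B12.Bound027Printed (fun X : (sys B).Dom => IsLarge027 (L ^ (k - j)) c X.1) EX E₀ κ (L : ℝ)
      (((L : ℝ) ^ k)⁻¹) j := by
  refine B12.bound027_of_025 _ EX E₀ κ (L : ℝ) _ j hκ h025 fun X hX => ?_
  have hN : 0 < L ^ (k - j) := pow_pos (lt_of_lt_of_le Nat.zero_lt_one hL) _
  rw [inv_scale_eq_pow hL hjk]
  exact two_mul_le_dj_of_isLarge027 B hN c X hX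

/-- **The large-domain half of (0.29) under the printed criterion** (p. 258 *"the first exponential can be bounded by an
arbitrary positive power of L^jη, e.g. by (5!/κ⁵)(L^jη)⁵. This power is enough to control the sums in (0.23), (0.24)"*;
pp. 271–272, the *"second, simpler case"*): on `sys B`, the family `X ↦ 𝐄^{(j)}(X, U_k)` restricted to the domains not
contained in any □̃ (□ ∈ π_k) satisfies `B12.Bound029Printed` with exponent `4 + (N′ − 4)` for EVERY `N′`, constant
`E₀·N′!/(δκ)^{N′}` and rate `(1 − δ)κ` (`B12.bound029_of_025_large`, whose hypothesis `(L^jη)^{−1} ≤ d_j(X)` on the large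
domains is supplied — with room, `2(L^jη)^{−1} ≤ d_j(X)` — by `two_mul_le_treeLen_of_isLarge027`).
[cite: Balaban1987RG1, p.258 ((0.27)–(0.29)), pp.271–272] -/
theorem bound029_of_025_isLarge027 (B : Finset (Pt d)) (EX : (sys B).Dom → ℝ) (E₀ κ δ : ℝ) {L j k : ℕ} (N' : ℕ)
    (hL : 1 ≤ L) (hjk : j ≤ k) (hκ : 0 < κ) (hδ : 0 < δ) (c : Pt d) (h025 : B12.Bound025Printed EX E₀ κ)
    [DecidablePred fun X : (sys B).Dom => IsLarge027 (L ^ (k - j)) c X.1] :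
    B12.Bound029Printed
      (fun X : (sys B).Dom => if IsLarge027 (L ^ (k - j)) c X.1 then EX X else 0)
      (E₀ * ((Nat.factorial N' : ℝ) / (δ * κ) ^ N')) (L : ℝ) (((L : ℝ) ^ k)⁻¹) ((N' : ℝ) - 4) ((1 - δ) * κ) j := by
  have hLpos : (0 : ℝ) < L := by exact_mod_cast (lt_of_lt_of_le Nat.zero_lt_one hL)
  have hs : 0 < (L : ℝ) ^ j * ((L : ℝ) ^ k)⁻¹ := by positivity
  refine B12.bound029_of_025_large _ EX E₀ κ δ (L : ℝ) _ j N' h025 hκ hδ hs fun X hX => ?_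
  have hN : 0 < L ^ (k - j) := pow_pos (lt_of_lt_of_le Nat.zero_lt_one hL) _
  have h2 := two_mul_le_dj_of_isLarge027 B hN c X hX
  rw [inv_scale_eq_pow hL hjk]
  have hN' : (0 : ℝ) ≤ ((L ^ (k - j) : ℕ) : ℝ) := Nat.cast_nonneg _
  linarith

/-! ## §5. Sharpness of the threshold: a straight row of 2N + 2 cubes is large and has d_j = 2N -/

/-- The straight row of `n + 1` unit cubes in direction μ starting at the cube z₀: indices `z₀ + t e_μ`, `t = 0, …, n`.
[folklore] -/
def row (z₀ : Pt d) (μ : Fin d) (n : ℕ) : Finset (Pt d) :=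
  (Finset.range (n + 1)).image fun t : ℕ => z₀ + Pi.single μ (t : ℤ)

/-- Membership in a row. [folklore] -/
private theorem mem_row {z₀ : Pt d} {μ : Fin d} {n : ℕ} {z : Pt d} :
    z ∈ row z₀ μ n ↔ ∃ t : ℕ, t ≤ n ∧ z = z₀ + Pi.single μ (t : ℤ) := by
  simp only [row, Finset.mem_image, Finset.mem_range, Nat.lt_succ_iff, eq_comm]

/-- A row of `2N + 2` cubes whose first cube ENDS at a wall of the partition π_k in direction μ (`z₀_μ + 1 = c_μ`) is
contained in no window □̃ of side 3N: the extremal large domain (for other placements a row must be longer — up to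
`3N + 1` cubes — before it sticks out of every □̃). [cite: Balaban1987RG1, p.258 ("not contained in any cube □̃")] -/
theorem isLarge027_row {N : ℕ} (hN : 0 < N) {z₀ : Pt d} {μ : Fin d} {c : Pt d} (hz : z₀ μ + 1 = c μ) :
    IsLarge027 N c (row z₀ μ (2 * N + 1)) := by
  intro b hsub
  have h0 : z₀ ∈ (row z₀ μ (2 * N + 1) : Set (Pt d)) := by
    rw [Finset.mem_coe, mem_row]; exact ⟨0, Nat.zero_le _, by simp⟩
  have h1 : z₀ + Pi.single μ ((2 * N + 1 : ℕ) : ℤ) ∈ (row z₀ μ (2 * N + 1) : Set (Pt d)) := by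
    rw [Finset.mem_coe, mem_row]; exact ⟨2 * N + 1, le_rfl, rfl⟩
  have ha := ((mem_window.1 (hsub h0)) μ).1
  have hb := ((mem_window.1 (hsub h1)) μ).2
  simp only [Pi.add_apply, Pi.single_eq_same] at hb
  push_cast at hb
  have hNz : (0 : ℤ) < N := by exact_mod_cast hN
  -- ha : N(b_μ − 1) + c_μ ≤ c_μ − 1, hb : c_μ + 2N < N(b_μ + 2) + c_μ
  rcases le_or_gt (b μ) 0 with hb0 | hb0
  · have : (N : ℤ) * b μ ≤ 0 := mul_nonpos_of_nonneg_of_nonpos hNz.le hb0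
    linarith
  · have hb1 : (1 : ℤ) ≤ b μ := hb0
    have : (N : ℤ) ≤ N * b μ := by nlinarith
    linarith

/-- A row is a localization domain in the sense of p. 257 (*"A connected family means that for every pair □, □′ of
cubes from the family there exists a sequence □, □₁, …, □_n, □′ of cubes belonging to the family and such that two
consecutive cubes have a common wall"*): consecutive cubes `z₀ + t e_μ`, `z₀ + (t+1) e_μ` have a common wall, so every
cube of the row is chain-connected to `z₀`. [cite: Balaban1987RG1, p.257 (localization domains)] -/
theorem faceConnected_row (z₀ : Pt d) (μ : Fin d) (n : ℕ) : FaceConnected (row z₀ μ n) := by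
  have key : ∀ t : ℕ, t ≤ n → Linked (row z₀ μ n) z₀ (z₀ + Pi.single μ (t : ℤ)) := by
    intro t ht
    induction t with
    | zero =>
      simp only [Nat.cast_zero, Pi.single_zero, add_zero]
      exact Relation.ReflTransGen.refl
    | succ t ih =>
      refine Relation.ReflTransGen.tail (ih (Nat.le_of_succ_le ht)) ⟨?_, ?_, ?_⟩
      · exact mem_row.2 ⟨t, Nat.le_of_succ_le ht, rfl⟩
      · exact mem_row.2 ⟨t + 1, ht, rfl⟩
      · refine ⟨μ, Or.inl ?_⟩
        ext i
        by_cases hi : i = μ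
        · subst hi
          simp only [Pi.add_apply, Pi.single_eq_same, Function.update_self, Nat.cast_succ]
          ring
        · simp only [Pi.add_apply, Pi.single_eq_of_ne hi, Function.update_of_ne hi]
  intro x hx y hy
  obtain ⟨t, ht, rfl⟩ := mem_row.1 hx
  obtain ⟨t', ht', rfl⟩ := mem_row.1 hy
  exact (key t ht).symm.trans (key t' ht')

/-- The row is met by ONE straight segment of sup-length `n − 1` (from the point `corner z₀ + 1·e_μ`, i.e. the far face of
the first cube, to `corner z₀ + n·e_μ`, the near face of the last), which is admissible; hence `d_j(row) ≤ n − 1`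
for `n ≥ 1`. With `n = 2N + 1`: `d_j ≤ 2N`, so the threshold `2N` of §3 is attained. [cite: Balaban1987RG1, p.257 (d_j)] -/
theorem treeLen_row_le (z₀ : Pt d) (μ : Fin d) {n : ℕ} (hn : 1 ≤ n) :
    treeLen (row z₀ μ n) ≤ (n : ℝ) - 1 := by
  -- the segment from P = corner z₀ + e_μ to Q = corner z₀ + n e_μ
  set P : RPt d := corner z₀ + Pi.single μ (1 : ℝ) with hP
  set Q : RPt d := corner z₀ + Pi.single μ (n : ℝ) with hQ
  have hPQ : dist P Q = (n : ℝ) - 1 := by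
    have hsub : P - Q = Pi.single μ ((1 : ℝ) - n) := by
      rw [hP, hQ, add_sub_add_left_eq_sub, ← Pi.single_sub]
    rw [dist_eq_norm, hsub, Pi.norm_single, Real.norm_eq_abs, abs_sub_comm, abs_of_nonneg]
    have : (1 : ℝ) ≤ n := by exact_mod_cast hn
    linarith
  -- points of the segment: P + s (Q − P), coordinates
  have hseg : ∀ x ∈ segment ℝ P Q, ∃ s : ℝ, 0 ≤ s ∧ s ≤ 1 ∧ x = corner z₀ + Pi.single μ (1 + s * ((n : ℝ) - 1)) := by
    intro x hx
    rw [segment_eq_image' ℝ] at hx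
    obtain ⟨s, ⟨hs0, hs1⟩, rfl⟩ := hx
    refine ⟨s, hs0, hs1, ?_⟩
    show P + s • (Q - P) = _
    rw [hP, hQ, add_sub_add_left_eq_sub, ← Pi.single_sub, ← Pi.single_smul', smul_eq_mul, add_assoc,
      ← Pi.single_add]
  have hadm : Admissible (row z₀ μ n) [(P, Q)] := by
    refine ⟨?_, ?_, ?_⟩
    · -- connected: one segment
      simpa [carrier] using (convex_segment P Q).isConnected ⟨P, left_mem_segment ℝ P Q⟩  -- isConnected of segment
    · -- contained in the cubes of the row: the point with parameter 1 + s(n−1) ∈ [1, n] lies in the cube t = ⌊·⌋ ∧ n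
      intro x hx
      have hx' : x ∈ segment ℝ P Q := by simpa [carrier] using hx
      obtain ⟨s, hs0, hs1, rfl⟩ := hseg x hx'
      set u : ℝ := 1 + s * ((n : ℝ) - 1) with hu
      have hn1 : (1 : ℝ) ≤ n := by exact_mod_cast hn
      have hu1 : 1 ≤ u := by rw [hu]; nlinarith
      have hun : u ≤ n := by rw [hu]; nlinarith
      -- the cube index t = min ⌊u⌋ (n − 1)... choose t := ⌊u⌋ if u < n, else n − 1; simpler: t := ⌈u⌉ − 1
      obtain ⟨t, ht0, htu, hut⟩ : ∃ t : ℕ, t ≤ n ∧ (t : ℝ) ≤ u ∧ u ≤ (t : ℝ) + 1 :=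
        ⟨⌊u⌋₊, (Nat.floor_le_floor hun).trans_eq (Nat.floor_natCast n), Nat.floor_le (by linarith),
          (Nat.lt_floor_add_one u).le⟩
      refine mem_cubes.2 ⟨z₀ + Pi.single μ (t : ℤ), mem_row.2 ⟨t, ht0, rfl⟩, mem_cube.2 fun i => ?_⟩
      by_cases hi : i = μ
      · subst hi
        simp only [Pi.add_apply, Pi.single_eq_same, corner, Int.cast_add, Int.cast_natCast]
        exact ⟨by linarith, by linarith⟩
      · simp only [Pi.add_apply, Pi.single_eq_of_ne hi, corner, add_zero]
        exact ⟨le_rfl, by linarith⟩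
    · -- meets every cube of the row: the cube t ∋ the point with u = max 1 t (parameter in [1, n])
      intro z hz
      obtain ⟨t, htn, rfl⟩ := mem_row.1 hz
      set u : ℝ := max 1 (t : ℝ) with hu
      have hn1 : (1 : ℝ) ≤ n := by exact_mod_cast hn
      have htn' : (t : ℝ) ≤ n := by exact_mod_cast htn
      have hu1 : 1 ≤ u := le_max_left _ _
      have hun : u ≤ n := max_le hn1 htn'
      refine ⟨corner z₀ + Pi.single μ u, ?_, mem_cube.2 fun i => ?_⟩
      · -- on the segment: parameter s = (u − 1)/(n − 1) (or any s when n = 1, where u = 1 and P = Q)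
        show corner z₀ + Pi.single μ u ∈ carrier [(P, Q)]
        simp only [carrier, Set.union_empty]
        rw [segment_eq_image' ℝ]
        rcases eq_or_lt_of_le hn1 with h1 | h1
        · refine ⟨0, ⟨le_rfl, zero_le_one⟩, ?_⟩
          have hu' : u = 1 := le_antisymm (h1 ▸ hun) hu1
          show P + (0 : ℝ) • (Q - P) = _
          simp [hP, hu']
        · refine ⟨(u - 1) / ((n : ℝ) - 1), ⟨div_nonneg (by linarith) (by linarith),
            (div_le_one (by linarith)).2 (by linarith)⟩, ?_⟩
          show P + ((u - 1) / ((n : ℝ) - 1)) • (Q - P) = _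
          rw [hP, hQ, add_sub_add_left_eq_sub, ← Pi.single_sub, ← Pi.single_smul', smul_eq_mul, add_assoc,
            ← Pi.single_add]
          congr 2
          field_simp
          ring
      · by_cases hi : i = μ
        · subst hi
          have hut : (t : ℝ) ≤ u := le_max_right _ _
          have hut1 : u ≤ (t : ℝ) + 1 := by
            rcases le_total 1 (t : ℝ) with h | h
            · rw [hu, max_eq_right h]; linarith
            · rw [hu, max_eq_left h]; linarith
          simp only [Pi.add_apply, Pi.single_eq_same, corner, Int.cast_add, Int.cast_natCast]
          exact ⟨by linarith, by linarith⟩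
        · simp only [Pi.add_apply, Pi.single_eq_of_ne hi, corner, add_zero]
          exact ⟨le_rfl, by linarith⟩
  calc treeLen (row z₀ μ n) ≤ len [(P, Q)] := treeLen_le_len hadm
    _ = (n : ℝ) - 1 := by simp [hPQ]

/-- **Sharpness**: the row of `2N + 2` cubes is large (`isLarge027_row`) and has `d_j ≤ 2N`; with §3, `d_j = 2N` exactly —
the threshold `2(L^jη)^{−1}` behind (0.27) cannot be raised, so print's ½ in `exp(−½κd_j(X))` is the best constant
obtainable from (0.25) and the criterion alone (row placed with `z₀_μ + 1 = c_μ`). [cite: Balaban1987RG1, p.258 ((0.27))] -/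
theorem treeLen_row_eq {N : ℕ} (hN : 0 < N) {z₀ : Pt d} {μ : Fin d} {c : Pt d} (hz : z₀ μ + 1 = c μ) :
    treeLen (row z₀ μ (2 * N + 1)) = 2 * (N : ℝ) := by
  refine le_antisymm ?_ ?_
  · have := treeLen_row_le z₀ μ (n := 2 * N + 1) (by omega)
    push_cast at this
    linarith
  · exact two_mul_le_treeLen_of_isLarge027 hN ⟨z₀, mem_row.2 ⟨0, Nat.zero_le _, by simp⟩⟩
      (faceConnected_row z₀ μ _) (isLarge027_row hN hz)

/-! ## §6 (v1.1). The same on the TORUS carrier of `TreeLengthTorus` (d_j := `torusTreeLen`), i.e. on the cube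
system `tsys` on which the cell's (0.26)/(0.30) "as printed" theorems live (`B12Chain026Torus`)

Print's T is a torus (p. 251) and π_k a partition of it; in the universal cover the cubes □̃, □ ∈ π_k, are the images
of the ℤ^d-windows `window N c b` under the covering projection `TreeLengthTorus.proj` (torus side = a multiple of N
π_j-cubes in print; the criterion below is stated for every side `Ntor`).  A torus localization domain X̄ is "not
contained in any cube □̃, with □ ∈ π_k" iff no window's image contains it: `TIsLarge027`.  The lifted admissible
graphs of `TreeLengthTorus.TAdmissible` meet ONE lift of each cube of X̄; if such a graph were shorter than 2N, the met
lifts would have coordinate spreads ≤ 2N, hence (the window lemma in spread form, `exists_window_of_spread_le`) lie in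
one ℤ^d-window, whose image would contain X̄.  So `d_j(X̄) ≥ 2N` on the torus too, and (0.27) AS PRINTED holds on
`tsys d Ntor` with print's criterion (`bound027_of_025_tIsLarge027`). -/

section Torus

open TreeLengthTorus

/-- THE WINDOW LEMMA IN SPREAD FORM: a non-empty finite family S ⊂ ℤ^d whose coordinate spreads are all `≤ 2N` lies in
some window □̃ of side 3N (integer position c): take `b_μ = ⌊(m_μ − c_μ)/N⌋ + 1` with `m_μ = min_{z∈S} z_μ`; then
`N(b_μ − 1) + c_μ ≤ m_μ ≤ z_μ ≤ m_μ + 2N < N(b_μ + 2) + c_μ` because `(m_μ − c_μ) − N⌊(m_μ − c_μ)/N⌋ ≤ N − 1`.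
(Geometry left implicit in print, p. 258.) [cite: Balaban1987RG1, p.258 ((0.27), "not contained in any cube □̃")] -/
theorem exists_window_of_spread_le {N : ℕ} (hN : 0 < N) (c : Pt d) {S : Finset (Pt d)} (hS : S.Nonempty)
    (hsp : ∀ z ∈ S, ∀ z' ∈ S, ∀ μ, z' μ - z μ ≤ 2 * (N : ℤ)) : ∃ b : Pt d, (S : Set (Pt d)) ⊆ window N c b := by
  have hmin : ∀ μ : Fin d, ∃ m ∈ S, ∀ z ∈ S, m μ ≤ z μ := fun μ =>
    Finset.exists_min_image S (fun z : Pt d => z μ) hS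
  choose m hmS hm using hmin
  have hNz : (0 : ℤ) < N := by exact_mod_cast hN
  refine ⟨fun μ => (m μ μ - c μ) / N + 1, fun z hz => ?_⟩
  have hz' : z ∈ S := by simpa using hz
  intro μ
  set a : ℤ := m μ μ - c μ with ha
  have hdecomp : a % N + N * (a / N) = a := Int.emod_add_mul_ediv a N
  have hr0 : 0 ≤ a % N := Int.emod_nonneg a (ne_of_gt hNz)
  have hrN : a % N < N := Int.emod_lt_of_pos a hNz
  have hlow : m μ μ ≤ z μ := hm μ z hz'
  have hspread : z μ - m μ μ ≤ 2 * (N : ℤ) := hsp (m μ) (hmS μ) z hz' μ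
  constructor
  · have : (N : ℤ) * ((m μ μ - c μ) / N + 1 - 1) = N * (a / N) := by rw [ha]; ring_nf
    rw [this]
    linarith
  · have : (N : ℤ) * ((m μ μ - c μ) / N + 1 + 2) = N * (a / N) + 3 * N := by rw [ha]; ring
    rw [this]
    linarith

variable {Ntor : ℕ}

/-- **"not contained in any cube □̃, with □ ∈ π_k" ON THE TORUS** (p. 258): the torus family X̄ ⊂ (ℤ/Ntor)^d of
π_j-cubes is contained in the image of NO ℤ^d-window `window N c b` under the covering projection `proj` (the images
are the cubes □̃ of the torus partition π_k, N = (L^jη)^{−1} π_j-cubes per π_k-cube, integer position c).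
[cite: Balaban1987RG1, p.258 (large localization domains, (0.27)); p.251 (the torus T)] -/
def TIsLarge027 (N : ℕ) (c : Pt d) (X : Finset (TPt d Ntor)) : Prop :=
  ∀ b : Pt d, ¬ ∀ a ∈ X, ∃ z ∈ window N c b, proj Ntor z = a

/-- **`d_j(X̄) ≥ 2(L^jη)^{−1}` on the torus** for every torus localization domain X̄ not contained in any □̃ (□ ∈ π_k):
a lifted admissible graph of length `< 2N` meets lifts whose coordinate spreads are `≤ 2N` (two met cubes `z, z′` have
points `p, q` on the graph with `z′_μ ≤ q_μ`, `p_μ ≤ z_μ + 1`, and `q_μ − p_μ ≤ dist(p, q) ≤` length, by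
`B12Decay510Window.dist_le_len`), so all met lifts lie in one window (`exists_window_of_spread_le`) and X̄ in its image —
contradiction. [cite: Balaban1987RG1, p.258 ((0.27)); p.257 (d_j)] -/
theorem two_mul_le_torusTreeLen_of_tIsLarge027 [NeZero Ntor] {N : ℕ} (hN : 0 < N) {c : Pt d}
    {X : Finset (TPt d Ntor)} (hX : X.Nonempty) (hc : TFaceConnected X) (h : TIsLarge027 N c X) :
    2 * (N : ℝ) ≤ torusTreeLen X := by
  obtain ⟨T₀, hT₀, -⟩ := exists_tAdmissible hX hc
  refine le_torusTreeLen ⟨T₀, hT₀⟩ fun T hT => ?_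
  by_contra hlt
  push Not at hlt
  -- one met lift per cube of X̄
  choose z hz hp using hT.meets
  classical
  set S : Finset (Pt d) := X.attach.image fun a => z a.1 a.2 with hSdef
  have hmemS : ∀ {s : Pt d}, s ∈ S → ∃ a, ∃ ha : a ∈ X, s = z a ha := by
    intro s hs
    rw [hSdef, Finset.mem_image] at hs
    obtain ⟨a, -, rfl⟩ := hs
    exact ⟨a.1, a.2, rfl⟩
  have hSne : S.Nonempty := by
    obtain ⟨a, ha⟩ := hX
    exact ⟨z a ha, Finset.mem_image.2 ⟨⟨a, ha⟩, Finset.mem_attach _ _, rfl⟩⟩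
  -- coordinate spreads of the met lifts are ≤ 2N
  have hsp : ∀ s ∈ S, ∀ s' ∈ S, ∀ μ, s' μ - s μ ≤ 2 * (N : ℤ) := by
    intro s hs s' hs' μ
    obtain ⟨a, ha, rfl⟩ := hmemS hs
    obtain ⟨a', ha', rfl⟩ := hmemS hs'
    obtain ⟨p, hpT, hpz⟩ := hp a ha
    obtain ⟨q, hqT, hqz⟩ := hp a' ha'
    have hp1 : p μ ≤ (z a ha μ : ℝ) + 1 := ((mem_cube.1 hpz) μ).2
    have hq1 : ((z a' ha' μ : ℤ) : ℝ) ≤ q μ := ((mem_cube.1 hqz) μ).1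
    have hpq : q μ - p μ ≤ dist p q := by
      have h1 := dist_le_pi_dist p q μ
      rw [Real.dist_eq, abs_sub_comm] at h1
      exact (le_abs_self _).trans h1
    have hlen : dist p q ≤ len T := dist_le_len hT.connected.isPreconnected hpT hqT
    have hreal : ((z a' ha' μ - z a ha μ : ℤ) : ℝ) < 2 * (N : ℝ) + 1 := by
      push_cast
      linarith
    have hint : z a' ha' μ - z a ha μ < 2 * (N : ℤ) + 1 := by exact_mod_cast hreal
    linarith
  obtain ⟨b, hb⟩ := exists_window_of_spread_le hN c hSne hsp
  exact h b fun a ha => ⟨z a ha, hb (Finset.mem_coe.2 (Finset.mem_image.2 ⟨⟨a, ha⟩, Finset.mem_attach _ _, rfl⟩)),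
    hz a ha⟩

/-- The same on the concrete torus `LocDomainSys` (`TreeLengthTorus.tsys d Ntor`, d_j := `torusTreeLen`): every large
torus localization domain has `(tsys d Ntor).dj X̄ ≥ 2N`. [cite: Balaban1987RG1, p.258 ((0.27))] -/
theorem two_mul_le_tdj_of_tIsLarge027 [NeZero Ntor] {N : ℕ} (hN : 0 < N) (c : Pt d) (X : (tsys d Ntor).Dom)
    (h : TIsLarge027 N c X.1) : 2 * (N : ℝ) ≤ (tsys d Ntor).dj X := by
  rw [tsys_dj]
  exact two_mul_le_torusTreeLen_of_tIsLarge027 hN X.2.1 X.2.2 h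

/-- **(0.27) AS PRINTED ON THE TORUS** (p. 258 [10]): on `TreeLengthTorus.tsys d Ntor` — the carrier of the cell's
(0.26)/(0.30) theorems `B12Chain026Torus.chain026Printed_torus`/`chain030Printed_torus` — for every `1 ≤ L`, `j ≤ k`,
`κ ≥ 0` and position `c` of π_k: (0.25) for the family `X̄ ↦ 𝐄^{(j)}(X̄, U_k)` implies, for every torus localization
domain *"not contained in any cube □̃, with □ ∈ π_k"* (`TIsLarge027 (L^{k−j}) c X̄`),
`|𝐄^{(j)}(X̄, U_k)| ≤ E₀ exp(−κ(L^jη)^{−1}) exp(−½κd_j(X̄))`, η = L^{−k}; no lower-bound hypothesis on d_j.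
[cite: Balaban1987RG1, (0.25) p.257, (0.27) p.258] -/
theorem bound027_of_025_tIsLarge027 [NeZero Ntor] (EX : (tsys d Ntor).Dom → ℝ) (E₀ κ : ℝ) {L j k : ℕ}
    (hL : 1 ≤ L) (hjk : j ≤ k) (hκ : 0 ≤ κ) (c : Pt d) (h025 : B12.Bound025Printed EX E₀ κ) :
    B12.Bound027Printed (fun X : (tsys d Ntor).Dom => TIsLarge027 (L ^ (k - j)) c X.1) EX E₀ κ (L : ℝ)
      (((L : ℝ) ^ k)⁻¹) j := by
  refine B12.bound027_of_025 _ EX E₀ κ (L : ℝ) _ j hκ h025 fun X hX => ?_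
  have hN : 0 < L ^ (k - j) := pow_pos (lt_of_lt_of_le Nat.zero_lt_one hL) _
  rw [inv_scale_eq_pow hL hjk]
  exact two_mul_le_tdj_of_tIsLarge027 hN c X hX

/-- The large-domain half of (0.29) ON THE TORUS under the printed criterion (`B12.bound029_of_025_large` on `tsys`,
its d_j-hypothesis supplied by `two_mul_le_tdj_of_tIsLarge027`). [cite: Balaban1987RG1, p.258 ((0.27)–(0.29)), pp.271–272] -/
theorem bound029_of_025_tIsLarge027 [NeZero Ntor] (EX : (tsys d Ntor).Dom → ℝ) (E₀ κ δ : ℝ) {L j k : ℕ} (N' : ℕ)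
    (hL : 1 ≤ L) (hjk : j ≤ k) (hκ : 0 < κ) (hδ : 0 < δ) (c : Pt d) (h025 : B12.Bound025Printed EX E₀ κ)
    [DecidablePred fun X : (tsys d Ntor).Dom => TIsLarge027 (L ^ (k - j)) c X.1] :
    B12.Bound029Printed
      (fun X : (tsys d Ntor).Dom => if TIsLarge027 (L ^ (k - j)) c X.1 then EX X else 0)
      (E₀ * ((Nat.factorial N' : ℝ) / (δ * κ) ^ N')) (L : ℝ) (((L : ℝ) ^ k)⁻¹) ((N' : ℝ) - 4) ((1 - δ) * κ) j := by
  have hLpos : (0 : ℝ) < L := by exact_mod_cast (lt_of_lt_of_le Nat.zero_lt_one hL)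
  have hs : 0 < (L : ℝ) ^ j * ((L : ℝ) ^ k)⁻¹ := by positivity
  refine B12.bound029_of_025_large _ EX E₀ κ δ (L : ℝ) _ j N' h025 hκ hδ hs fun X hX => ?_
  have hN : 0 < L ^ (k - j) := pow_pos (lt_of_lt_of_le Nat.zero_lt_one hL) _
  have h2 := two_mul_le_tdj_of_tIsLarge027 hN c X hX
  rw [inv_scale_eq_pow hL hjk]
  have hN' : (0 : ℝ) ≤ ((L ^ (k - j) : ℕ) : ℝ) := Nat.cast_nonneg _
  linarith

end Torus

end Literature.MathematicalPhysics.QuantumFieldTheory.Balaban1983to89.B12LargeDomain027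

end
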